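import Mathlib
import Summits.ValiantsHypothesis.ValiantsHypothesis.Theses.LiouvilleSarnak
import Summits.ValiantsHypothesis.ValiantsHypothesis.Theorems.LiouvilleSarnakAlignedTypeIOfDigitalBilinear
import Summits.ValiantsHypothesis.ValiantsHypothesis.Theorems.LiouvilleSarnakAlignedTypeITransposedHolds

/-!
# Route LiouvilleSarnak — crux `DigitalBilinearLiouville` (stmt-ValiantsHypothesis-14774) in rectangle
# currency: the ALIGNED cut — full rows × any columns is PROVED, any rows × full columns is `AlignedTypeI`

`Theorems/LiouvilleSarnakDigitalBilinearLiouvilleRectangles.lean` puts the crux in rectangle-discrepancy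
currency: `DigitalBilinearLiouville ⟺ ∀ ε ∃ n₀ ∀ n ≥ n₀ ∀ π ∀ A B ⊆ {0,1}^n,
|Σ_{r ∈ A} Σ_{c ∈ B} λ(N_π(r, c) + 1)| ≤ ε 4^n`.  On the ALIGNED cut
`π₀ = finSumFinEquiv.trans (finCongr (two_mul n).symm)` (row bits = the `n` low digits, column bits =
the `n` high digits; `N_{π₀}(r, c) = ofBits r + 2^n · ofBits c`, tree lemma
`CharactersModTwoN.ofBits_alignedCut`) the rectangle sums are
`Σ_{a ∈ A} Σ_{b ∈ B} λ(a + 2^n b + 1)` — `λ` summed over the positions `A` inside each of the blocks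
`B` of length `2^n = √X`.  This file places the two one-sided families:

* `rectangles_aligned_fullRows` — ★ FULL ROWS × ANY COLUMNS is PROVED, unconditionally: for every
  `ε > 0`, eventually `|Σ_{r} Σ_{c ∈ B} λ(N_{π₀}(r, c) + 1)| ≤ ε 4^n` for EVERY set `B` of blocks
  (`≤ Σ_{b<2^n} |Σ_{a<2^n} λ(a + 2^n b + 1)| ≤ ε 4^n`, the transposed aligned rung
  `AlignedTypeI.Transposed.alignedTypeI_transposed`, i.e. Matomäki–Radziwiłł in almost all short
  intervals, proved in the tree).
* `alignedTypeI_iff_rectangles_aligned_fullCols` — ANY ROWS × FULL COLUMNS is EXACTLY the open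
  support item `AlignedTypeI` (stmt-21040): `Σ_a |Σ_b λ(a + 2^n b + 1)| ≤ ε 4^n` bounds every
  `|Σ_{r ∈ A} Σ_c λ|`, and conversely the row set `A = {a : Σ_b λ(a + 2^n b + 1) ≥ 0}` and its
  complement recover the `ℓ¹` sum (`ε ↦ 2ε`).

So in rectangle currency the ladder at the aligned cut reads: `univ × B` ✓ (MR) — `A × univ` =
`AlignedTypeI` (open; characters mod `2^n` at `x = q²`) — `A × B` = the aligned instance of the crux.

Honest framing: placement lemmas; `AlignedTypeI`, `DigitalBilinearLiouville`, `LiouvilleCutRank` and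
`AlgebraicSarnak` stay OPEN, and nothing here bears on VP versus VNP.  No definitions.
-/

-- the directory `ValiantsHypothesis/ValiantsHypothesis` repeats the summit name (tree layout)
set_option linter.dupNamespace false

namespace Summit.ValiantsHypothesis.ValiantsHypothesis.Theorems.LiouvilleSarnakDigitalBilinearLiouville.Rectangles

open Finset ArithmeticFunction

open Summit.ValiantsHypothesis.ValiantsHypothesis.Theses.LiouvilleSarnak (AlignedTypeI)
open Summit.ValiantsHypothesis.ValiantsHypothesis.Theorems.LiouvilleSarnak.AlignedTypeI.CharactersModTwoN
  (ofBits_alignedCut sum_boolVec_eq_sum_fin)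
open Summit.ValiantsHypothesis.ValiantsHypothesis.Theorems.LiouvilleSarnak.AlignedTypeI.Transposed
  (alignedTypeI_transposed)

/-- The aligned cut matrix entry at `(r, c)` is `λ(ofBits r + 2^n ofBits c + 1)`. [folklore] -/
theorem alignedCut_entry (n : ℕ) (r c : Fin n → Bool) :
    (((liouville (Nat.ofBits (fun j : Fin (2 * n) =>
        Sum.elim r c ((finSumFinEquiv.trans (finCongr (two_mul n).symm)).symm j)) + 1) : ℤ) : ℝ)) =
      ((liouville (Nat.ofBits r + 2 ^ n * Nat.ofBits c + 1) : ℤ) : ℝ) := by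
  rw [ofBits_alignedCut]

/-- ★ **Full rows × any columns on the aligned cut, PROVED.**  For every `ε > 0`, eventually, for
every set `B` of column digit strings,
`|Σ_{r ∈ {0,1}^n} Σ_{c ∈ B} λ(N_{π₀}(r, c) + 1)| ≤ ε · 4^n` on the aligned cut `π₀`: the inner sums are
sums of `λ` over the whole blocks `[2^n b + 1, 2^n (b + 1)]`, `b = ofBits c`, and
`Σ_{b<2^n} |Σ_{a<2^n} λ(a + 2^n b + 1)| ≤ ε 4^n` (Matomäki–Radziwiłł, tree theorem
`alignedTypeI_transposed`). [cite: MatomakiRadziwillAnnals2016, Theorem 1] -/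
theorem rectangles_aligned_fullRows :
    ∀ ε : ℝ, 0 < ε → ∃ n₀ : ℕ, ∀ n ≥ n₀, ∀ B : Finset (Fin n → Bool),
      |∑ r : Fin n → Bool, ∑ c ∈ B, ((liouville (Nat.ofBits (fun j : Fin (2 * n) =>
        Sum.elim r c ((finSumFinEquiv.trans (finCongr (two_mul n).symm)).symm j)) + 1) : ℤ) : ℝ)| ≤
        ε * 4 ^ n := by
  classical
  intro ε hε
  obtain ⟨n₀, hn₀⟩ := alignedTypeI_transposed ε hε
  refine ⟨n₀, fun n hn B => ?_⟩
  simp_rw [alignedCut_entry]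
  rw [Finset.sum_comm]
  -- `|Σ_{c ∈ B} X_c| ≤ Σ_{c ∈ B} |X_c| ≤ Σ_c |X_c|`
  have h1 : |∑ c ∈ B, ∑ r : Fin n → Bool,
      ((liouville (Nat.ofBits r + 2 ^ n * Nat.ofBits c + 1) : ℤ) : ℝ)| ≤
      ∑ c : Fin n → Bool, |∑ r : Fin n → Bool,
        ((liouville (Nat.ofBits r + 2 ^ n * Nat.ofBits c + 1) : ℤ) : ℝ)| :=
    (Finset.abs_sum_le_sum_abs _ _).trans
      (Finset.sum_le_univ_sum_of_nonneg fun c => abs_nonneg _)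
  -- re-index rows and columns by the integers they encode
  have h2 : ∑ c : Fin n → Bool, |∑ r : Fin n → Bool,
      ((liouville (Nat.ofBits r + 2 ^ n * Nat.ofBits c + 1) : ℤ) : ℝ)| =
      ∑ b : Fin (2 ^ n), |∑ a : Fin (2 ^ n), ((liouville ((a : ℕ) + 2 ^ n * (b : ℕ) + 1) : ℤ) : ℝ)| := by
    have hinner : ∀ c : Fin n → Bool, ∑ r : Fin n → Bool,
        ((liouville (Nat.ofBits r + 2 ^ n * Nat.ofBits c + 1) : ℤ) : ℝ) =
        ∑ a : Fin (2 ^ n), ((liouville ((a : ℕ) + 2 ^ n * Nat.ofBits c + 1) : ℤ) : ℝ) := fun c =>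
      sum_boolVec_eq_sum_fin n (fun x => ((liouville (x + 2 ^ n * Nat.ofBits c + 1) : ℤ) : ℝ))
    simp_rw [hinner]
    exact sum_boolVec_eq_sum_fin n
      (fun y => |∑ a : Fin (2 ^ n), ((liouville ((a : ℕ) + 2 ^ n * y + 1) : ℤ) : ℝ)|)
  exact h1.trans (h2 ▸ hn₀ n hn)

/-- **Any rows × full columns on the aligned cut is `AlignedTypeI`.**  The support item `AlignedTypeI`
(stmt-ValiantsHypothesis-21040: `Σ_a |Σ_b λ(a + 2^n b + 1)| ≤ ε 4^n` eventually) holds iff for every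
`ε > 0`, eventually, `|Σ_{r ∈ A} Σ_{c} λ(N_{π₀}(r, c) + 1)| ≤ ε 4^n` for every set `A` of row digit
strings on the aligned cut `π₀` (⇒: triangle inequality; ⇐: take `A` = the rows with nonnegative row
sum and its complement, `ε ↦ ε/2`). [folklore] -/
theorem alignedTypeI_iff_rectangles_aligned_fullCols :
    AlignedTypeI ↔
      ∀ ε : ℝ, 0 < ε → ∃ n₀ : ℕ, ∀ n ≥ n₀, ∀ A : Finset (Fin n → Bool),
        |∑ r ∈ A, ∑ c : Fin n → Bool, ((liouville (Nat.ofBits (fun j : Fin (2 * n) =>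
          Sum.elim r c ((finSumFinEquiv.trans (finCongr (two_mul n).symm)).symm j)) + 1) : ℤ) : ℝ)| ≤
          ε * 4 ^ n := by
  classical
  constructor
  · intro h ε hε
    obtain ⟨n₀, hn₀⟩ := h ε hε
    refine ⟨n₀, fun n hn A => ?_⟩
    simp_rw [alignedCut_entry]
    have h1 : |∑ r ∈ A, ∑ c : Fin n → Bool,
        ((liouville (Nat.ofBits r + 2 ^ n * Nat.ofBits c + 1) : ℤ) : ℝ)| ≤
        ∑ r : Fin n → Bool, |∑ c : Fin n → Bool,
          ((liouville (Nat.ofBits r + 2 ^ n * Nat.ofBits c + 1) : ℤ) : ℝ)| :=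
      (Finset.abs_sum_le_sum_abs _ _).trans
        (Finset.sum_le_univ_sum_of_nonneg fun r => abs_nonneg _)
    have h2 : ∑ r : Fin n → Bool, |∑ c : Fin n → Bool,
        ((liouville (Nat.ofBits r + 2 ^ n * Nat.ofBits c + 1) : ℤ) : ℝ)| =
        ∑ a : Fin (2 ^ n), |∑ b : Fin (2 ^ n),
          ((liouville ((a : ℕ) + 2 ^ n * (b : ℕ) + 1) : ℤ) : ℝ)| := by
      have hinner : ∀ r : Fin n → Bool, ∑ c : Fin n → Bool,
          ((liouville (Nat.ofBits r + 2 ^ n * Nat.ofBits c + 1) : ℤ) : ℝ) =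
          ∑ b : Fin (2 ^ n), ((liouville (Nat.ofBits r + 2 ^ n * (b : ℕ) + 1) : ℤ) : ℝ) := fun r =>
        sum_boolVec_eq_sum_fin n (fun y => ((liouville (Nat.ofBits r + 2 ^ n * y + 1) : ℤ) : ℝ))
      simp_rw [hinner]
      exact sum_boolVec_eq_sum_fin n
        (fun x => |∑ b : Fin (2 ^ n), ((liouville (x + 2 ^ n * (b : ℕ) + 1) : ℤ) : ℝ)|)
    exact h1.trans (h2 ▸ hn₀ n hn)
  · intro h ε hε
    obtain ⟨n₀, hn₀⟩ := h (ε / 2) (by positivity)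
    refine ⟨n₀, fun n hn => ?_⟩
    -- row sums indexed by bit vectors
    set X : (Fin n → Bool) → ℝ := fun r => ∑ c : Fin n → Bool,
      ((liouville (Nat.ofBits r + 2 ^ n * Nat.ofBits c + 1) : ℤ) : ℝ) with hX
    have hrect : ∀ A : Finset (Fin n → Bool), |∑ r ∈ A, X r| ≤ ε / 2 * 4 ^ n := by
      intro A
      have := hn₀ n hn A
      simp_rw [alignedCut_entry] at this
      exact this
    -- `Σ_r |X r| = Σ_{A⁺} X - Σ_{A⁻} X`
    set Ap : Finset (Fin n → Bool) := Finset.univ.filter (fun r => 0 ≤ X r) with hAp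
    set Am : Finset (Fin n → Bool) := Finset.univ.filter (fun r => ¬ 0 ≤ X r) with hAm
    have hsplit : ∑ r : Fin n → Bool, |X r| = ∑ r ∈ Ap, X r - ∑ r ∈ Am, X r := by
      rw [← Finset.sum_filter_add_sum_filter_not Finset.univ (fun r => 0 ≤ X r) (fun r => |X r|)]
      have hp : ∑ r ∈ Ap, |X r| = ∑ r ∈ Ap, X r :=
        Finset.sum_congr rfl fun r hr => abs_of_nonneg (Finset.mem_filter.mp hr).2
      have hm : ∑ r ∈ Am, |X r| = - ∑ r ∈ Am, X r := by
        rw [← Finset.sum_neg_distrib]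
        exact Finset.sum_congr rfl fun r hr =>
          abs_of_neg (not_le.mp (Finset.mem_filter.mp hr).2)
      rw [hp, hm]
      ring
    have hbound : ∑ r : Fin n → Bool, |X r| ≤ ε * 4 ^ n := by
      rw [hsplit]
      have h1 := (le_abs_self _).trans (hrect Ap)
      have h2 := (neg_le_abs _).trans (hrect Am)
      linarith
    -- re-index by integers
    have h2 : ∑ r : Fin n → Bool, |X r| =
        ∑ a : Fin (2 ^ n), |∑ b : Fin (2 ^ n),
          ((liouville ((a : ℕ) + 2 ^ n * (b : ℕ) + 1) : ℤ) : ℝ)| := by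
      have hinner : ∀ r : Fin n → Bool, X r =
          ∑ b : Fin (2 ^ n), ((liouville (Nat.ofBits r + 2 ^ n * (b : ℕ) + 1) : ℤ) : ℝ) := fun r =>
        sum_boolVec_eq_sum_fin n (fun y => ((liouville (Nat.ofBits r + 2 ^ n * y + 1) : ℤ) : ℝ))
      simp_rw [hinner]
      exact sum_boolVec_eq_sum_fin n
        (fun x => |∑ b : Fin (2 ^ n), ((liouville (x + 2 ^ n * (b : ℕ) + 1) : ℤ) : ℝ)|)
    rw [← h2]
    exact hbound

end Summit.ValiantsHypothesis.ValiantsHypothesis.Theorems.LiouvilleSarnakDigitalBilinearLiouville.Rectangles
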